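import Summits.ResolutionOfSingularities.ResolutionOfSingularities.Theorems.FrobeniusLadderFInjectiveMacaulayficationIsoLocusTransport
import Mathlib.Topology.Closure
import HarnessLib

/-!
# Where the bad points of a strongly confined step lie (crux `FInjectiveMacaulayfication`, hole #3, measure bookkeeping R3)

[OURS · L1 W4.5a] Support file for crux stmt-ResolutionOfSingularities-15315
(`Summit.ResolutionOfSingularities.ResolutionOfSingularities.Theses.FrobeniusLadder.FInjectiveMacaulayfication`, route
`FrobeniusLadder`, skeleton v11 `86e9127b5c98b8e6`), hole #3 = registered stub `stub_genericFInjectivization`.  CRUX-PLAN v4 §3.3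
(R3) proposes, for a tower of STRONGLY confined steps (H10-strong, `HoleThreeInterfaces2.ConfinedIsoStepStrong`: `π : X₂ ⟶ X₁` an
isomorphism over an open `U` containing every GOOD point off `closure {η}`, and every point of `X₂` over `η` good), the measure
`lex(dim Bad, #components of maximal dimension)` and says it «drops trivially».  This file records exactly what IS formal:

* `bad_base_of_strongStep` — **bookkeeping**: a bad point `x` of `X₂` lies over a point `π x ≠ η` which is either a bad point of `X₁`
  or a point of `closure {η}` (iso-locus transport `IsoLocusTransport.not_fiClause_base_of_isIso_morphismRestrict` over `U`, the
  hypothesis on the fibre over `η`, and `U ⊇ Good ∖ closure {η}`);  `bad_subset_preimage_of_strongStep` — the same as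
  `Bad(X₂) ⊆ π⁻¹((Bad(X₁) ∪ closure {η}) ∖ {η})`.

CAVEAT recorded for the planner (not a theorem): this inclusion does NOT make `dim Bad` drop — the preimage of the closed set
`(Bad(X₁) ∪ closure {η}) ∖ U` under a blow-up has fibres of positive dimension, so the bad locus of `X₂` over `closure {η} ∖ {η}` (or over
another bad component that `π` happens to modify) can have dimension `≥ dim closure {η}`; a drop of `lex(dim Bad, ·)` needs an extra
hypothesis on the step («the bad locus of `X₂` over `X₁ ∖ U` has dimension `< dim closure {η}`»), which H10-strong does not contain.
Folklore set theory over the landed H8; no definition is declared; AI-written, weaker than expert review; no statement of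
[claim: Hironaka2017] is used.
-/

-- single-problem summit: the doubled namespace component `ResolutionOfSingularities` is forced
set_option linter.dupNamespace false

noncomputable section

open CategoryTheory AlgebraicGeometry TopologicalSpace RingTheory.Sequence
open Summit.ResolutionOfSingularities.ResolutionOfSingularities.Theorems.FInjectiveMacaulayfication

namespace Summit.ResolutionOfSingularities.ResolutionOfSingularities.Theorems.FInjectiveMacaulayfication.StrongStepBadLocus

/-- **Bad points of a strongly confined step lie over `(Bad(X₁) ∪ closure {η}) ∖ {η}`.** Let `π : X₂ ⟶ X₁` be an isomorphism over
the open `U`, suppose `U` contains every point of `X₁` satisfying the full clause and lying outside `closure {η}`, and suppose every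
point of `X₂` over `η` satisfies the full clause.  Then for every point `x` of `X₂` at which the full clause FAILS: `π x ≠ η`, and either
the clause fails at `π x` or `π x ∈ closure {η}`. [folklore] -/
theorem bad_base_of_strongStep (p : ℕ) {X₂ X₁ : Scheme.{0}} (π : X₂ ⟶ X₁) (U : X₁.Opens) [IsIso (π ∣_ U)] (η : X₁)
    (hU : ∀ y : X₁, (IsDomain (X₁.presheaf.stalk y) ∧
      ∀ d : ℕ, ringKrullDim (X₁.presheaf.stalk y) = d →
        ∀ s : Fin d → X₁.presheaf.stalk y, (Ideal.span (Set.range s)).radical.IsMaximal →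
          IsWeaklyRegular (X₁.presheaf.stalk y) (List.ofFn s) ∧
          ∀ w : X₁.presheaf.stalk y, (∃ e : ℕ, w ^ p ^ e ∈ Ideal.span
            ((fun z : X₁.presheaf.stalk y => z ^ p ^ e) ''
              (Ideal.span (Set.range s) : Set (X₁.presheaf.stalk y)))) → w ∈ Ideal.span (Set.range s)) →
      y ∉ closure ({η} : Set X₁) → y ∈ (U : Set X₁))
    (hη : ∀ x : X₂, π.base x = η → IsDomain (X₂.presheaf.stalk x) ∧
      ∀ d : ℕ, ringKrullDim (X₂.presheaf.stalk x) = d →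
        ∀ s : Fin d → X₂.presheaf.stalk x, (Ideal.span (Set.range s)).radical.IsMaximal →
          IsWeaklyRegular (X₂.presheaf.stalk x) (List.ofFn s) ∧
          ∀ w : X₂.presheaf.stalk x, (∃ e : ℕ, w ^ p ^ e ∈ Ideal.span
            ((fun z : X₂.presheaf.stalk x => z ^ p ^ e) ''
              (Ideal.span (Set.range s) : Set (X₂.presheaf.stalk x)))) → w ∈ Ideal.span (Set.range s))
    (x : X₂)
    (hbad : ¬ (IsDomain (X₂.presheaf.stalk x) ∧
      ∀ d : ℕ, ringKrullDim (X₂.presheaf.stalk x) = d →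
        ∀ s : Fin d → X₂.presheaf.stalk x, (Ideal.span (Set.range s)).radical.IsMaximal →
          IsWeaklyRegular (X₂.presheaf.stalk x) (List.ofFn s) ∧
          ∀ w : X₂.presheaf.stalk x, (∃ e : ℕ, w ^ p ^ e ∈ Ideal.span
            ((fun z : X₂.presheaf.stalk x => z ^ p ^ e) ''
              (Ideal.span (Set.range s) : Set (X₂.presheaf.stalk x)))) → w ∈ Ideal.span (Set.range s))) :
    π.base x ≠ η ∧
    (¬ (IsDomain (X₁.presheaf.stalk (π.base x)) ∧
      ∀ d : ℕ, ringKrullDim (X₁.presheaf.stalk (π.base x)) = d →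
        ∀ s : Fin d → X₁.presheaf.stalk (π.base x), (Ideal.span (Set.range s)).radical.IsMaximal →
          IsWeaklyRegular (X₁.presheaf.stalk (π.base x)) (List.ofFn s) ∧
          ∀ w : X₁.presheaf.stalk (π.base x), (∃ e : ℕ, w ^ p ^ e ∈ Ideal.span
            ((fun z : X₁.presheaf.stalk (π.base x) => z ^ p ^ e) ''
              (Ideal.span (Set.range s) : Set (X₁.presheaf.stalk (π.base x))))) → w ∈ Ideal.span (Set.range s)) ∨
    π.base x ∈ closure ({η} : Set X₁)) := by
  refine ⟨fun h => hbad (hη x h), ?_⟩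
  by_cases hxU : π.base x ∈ U
  · exact Or.inl (IsoLocusTransport.not_fiClause_base_of_isIso_morphismRestrict p π U x hxU hbad)
  · by_contra h
    push Not at h
    exact hxU (hU (π.base x) h.1 h.2)

/-- **Set form**: `Bad(X₂) ⊆ π⁻¹((Bad(X₁) ∪ closure {η}) ∖ {η})` for a strongly confined step (hypotheses as in
`bad_base_of_strongStep`). [folklore] -/
theorem bad_subset_preimage_of_strongStep (p : ℕ) {X₂ X₁ : Scheme.{0}} (π : X₂ ⟶ X₁) (U : X₁.Opens) [IsIso (π ∣_ U)]
    (η : X₁)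
    (hU : ∀ y : X₁, (IsDomain (X₁.presheaf.stalk y) ∧
      ∀ d : ℕ, ringKrullDim (X₁.presheaf.stalk y) = d →
        ∀ s : Fin d → X₁.presheaf.stalk y, (Ideal.span (Set.range s)).radical.IsMaximal →
          IsWeaklyRegular (X₁.presheaf.stalk y) (List.ofFn s) ∧
          ∀ w : X₁.presheaf.stalk y, (∃ e : ℕ, w ^ p ^ e ∈ Ideal.span
            ((fun z : X₁.presheaf.stalk y => z ^ p ^ e) ''
              (Ideal.span (Set.range s) : Set (X₁.presheaf.stalk y)))) → w ∈ Ideal.span (Set.range s)) →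
      y ∉ closure ({η} : Set X₁) → y ∈ (U : Set X₁))
    (hη : ∀ x : X₂, π.base x = η → IsDomain (X₂.presheaf.stalk x) ∧
      ∀ d : ℕ, ringKrullDim (X₂.presheaf.stalk x) = d →
        ∀ s : Fin d → X₂.presheaf.stalk x, (Ideal.span (Set.range s)).radical.IsMaximal →
          IsWeaklyRegular (X₂.presheaf.stalk x) (List.ofFn s) ∧
          ∀ w : X₂.presheaf.stalk x, (∃ e : ℕ, w ^ p ^ e ∈ Ideal.span
            ((fun z : X₂.presheaf.stalk x => z ^ p ^ e) ''
              (Ideal.span (Set.range s) : Set (X₂.presheaf.stalk x)))) → w ∈ Ideal.span (Set.range s)) :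
    {x : X₂ | ¬ (IsDomain (X₂.presheaf.stalk x) ∧
      ∀ d : ℕ, ringKrullDim (X₂.presheaf.stalk x) = d →
        ∀ s : Fin d → X₂.presheaf.stalk x, (Ideal.span (Set.range s)).radical.IsMaximal →
          IsWeaklyRegular (X₂.presheaf.stalk x) (List.ofFn s) ∧
          ∀ w : X₂.presheaf.stalk x, (∃ e : ℕ, w ^ p ^ e ∈ Ideal.span
            ((fun z : X₂.presheaf.stalk x => z ^ p ^ e) ''
              (Ideal.span (Set.range s) : Set (X₂.presheaf.stalk x)))) → w ∈ Ideal.span (Set.range s))} ⊆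
    π.base ⁻¹' (({y : X₁ | ¬ (IsDomain (X₁.presheaf.stalk y) ∧
      ∀ d : ℕ, ringKrullDim (X₁.presheaf.stalk y) = d →
        ∀ s : Fin d → X₁.presheaf.stalk y, (Ideal.span (Set.range s)).radical.IsMaximal →
          IsWeaklyRegular (X₁.presheaf.stalk y) (List.ofFn s) ∧
          ∀ w : X₁.presheaf.stalk y, (∃ e : ℕ, w ^ p ^ e ∈ Ideal.span
            ((fun z : X₁.presheaf.stalk y => z ^ p ^ e) ''
              (Ideal.span (Set.range s) : Set (X₁.presheaf.stalk y)))) → w ∈ Ideal.span (Set.range s))} ∪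
        closure ({η} : Set X₁)) \ {η}) := by
  intro x hx
  obtain ⟨hne, h⟩ := bad_base_of_strongStep p π U η hU hη x hx
  exact ⟨h, hne⟩

end Summit.ResolutionOfSingularities.ResolutionOfSingularities.Theorems.FInjectiveMacaulayfication.StrongStepBadLocus

end
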